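import Literature.Algebra.EuclideanLattices.MRThm59AttemptRun
import Literature.Algebra.EuclideanLattices.MRThm59Shell
import Literature.Algebra.EuclideanLattices.IntegerMatrixInverseMachine
import Literature.Computability.Cryptography.PeikertMachineFP
import Literature.Computability.Cryptography.RegevGIVPPost
import Literature.Computability.Complexity.CodeFPBudgets
import Literature.Computability.Complexity.CodeFPLists
import Literature.Computability.Complexity.CodeFPOfUnary
import Literature.Probability.Distributions.PseudoGaussianSamplerStdDiscreteGaussian
import HarnessLib

/-!
# MR07 Thm. 5.9, the attempt machine II: the run is typed polynomial time, and `H59a`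

Topic `Algebra/EuclideanLattices` (family `pqc`), sequel of `MRThm59AttemptRun.lean` (the run of one
attempt of Micciancio–Regev 2007, Thm. 5.9 as a total list program `RunCtx.runOut` on the context
`ctxOf qf mf βhat pS pB J i`) and the coin law there. This file proves the run
computable in polynomial time in the typed sense of `CodeFP.lean`, as a function of the input
`⟨code J, ⟨1ⁱ, w⟩⟩` and the coins, by assembling the existing typed leaves: Cohen's integral inverse
(`GSInverse.invCols_codeFP`, `invDen_codeFP`), the coin-driven sampler and its standard record
(`samplerOf_codeFP`, `Peikert2009.Spec.stdCtx_codeFP` / `stdCoinLen_codeFP`), the guessed-coin call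
(`GuessedCoinCall.callRun_codeFP`), the total decoder (`Regev2009.GIVPPost.readVec_codeFP`) and the list
algebra (`CodeFP.map`/`zipWith`/`mapIdx`, `dotZ_codeFP`). No machine, transducer or tape is written.

* the list primitives and the programs of `DualGridProgram` on codes (`addL_codeFP`, …, `uVecL_codeFP`)
  against the code `attDE` of the list data;
* the components of `ctxOf` on codes (`ccOfJ_codeFP` = `invDen(U)^{2n−2}`, `BrowsOfJ_codeFP`, `DgOfJ_codeFP`,
  `alphaOfJ_codeFP`, `j0OfJ_codeFP`, `N2OfJ_codeFP`, `N1OfJ_codeFP`, `NOfJ_codeFP`, `SrowsOfJ_codeFP`,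
  `TSrowsOfJ_codeFP`, `dTOfJ_codeFP`, `attDataOfJ_codeFP`, `XOfJ_codeFP`, `bOfJ_codeFP`, `PctxOfJ_codeFP`,
  `coinLenOfJ_codeFP`, `ellOfJ_codeFP`, `ROfJ_codeFP`, `TshOfJ_codeFP`), from unary codes of the public
  parameters `q`, `m`, `β̂`;
* the run against an abstract MACHINE CONTEXT `MCtx` (the list data, `m`, `j₀`, `Tsh`, the sampler's record
  and coin length, `ℓ`, `W`, `R`; code `mctxE`): `MCtx.Ks/kappas/aRows/valRows/query/zAns/runOut/coinTotal`
  with `mcKs_codeFP`, …, **`mcRunOut_codeFP`**, `mcCoinTotal_codeFP`; the context `mctxOf` of `(J, i)` with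
  `runOut_mctxOf` (the machine run IS `RunCtx.runOut` of `ctxOf`: `samplerOf_ctx`,
  `readVec_eq_ofFn_decodeIntVec`), `coinTotal_mctxOf`, `mctxOf_codeFP`; hence **`runOut_codeFP`** (the run on
  the code of `(⟨J, ⟨1ⁱ, w⟩⟩, coins)`) and `exists_poly_coinTotal_le` (a polynomial bound on the coins in the
  length of the proper input);
* `map_runOut_ctxOf_eq` and **`exists_attMachine`** — a PPT `Att` (`run x r = F (boolPair x r)` for the `FP`
  realiser, `coinLen = pA`) whose output law on `⟨J, ⟨1ⁱ, w⟩⟩`, `i = guessIdx β̂ j₀ a`, is the fine-grid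
  model read through `zOf J` (`map_runOut_eq_naturalAttemptWith`), the hypothesis `hlaw` of
  `MRThm59Attempt.attempt_success_of_law`;
* **`H59a_holds`** — the machine-level single attempt of MR07 Thm. 5.9 (the hypothesis `H59a` of
  `MRThm59Shell.owfExist_of_gapSVP_worstCaseHard_of_incGDDAttempt`): the parameters on unary codes
  (`IsPolyTimeParams`, `codeFP_unary_of_natParam`, `codeFP_unary_floor`), the call's lengths
  `R = pB(matBound)`, `W = size R` (`GuessedCoinCall.le_toReal_callLaw`, `SIS.length_encodeMatrix_le`), the
  samplers `std (precOf p n) b` (`PGParams.tvDist_lawPMF_std_discreteGaussianInt_le`, `eventually_precOf_le`),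
  one machine per precision polynomial (`exists_attMachine`), and `MRThm59Attempt.attempt_success_of_law`.

## References

* D. Micciancio, O. Regev, *Worst-case to average-case reductions based on Gaussian measures*,
  SIAM J. Comput. 37 (2007) 267–302; authors' version, Thm. 5.9 ("there is a probabilistic polynomial
  time reduction", steps 1–4, p. 22) [MicciancioRegev2007].
* S. Arora, B. Barak, *Computational Complexity: A Modern Approach*, CUP 2009, §1.3 (polynomial time is
  closed under composition and polynomially bounded loops), Def. 7.1 [AroraBarak2009].
-/

noncomputable section

open scoped Classical

namespace Literature.Algebra.EuclideanLattices

open Matrix GSInverse Finset Literature.Probability.Distributions MRLemma510 DualGrid PMF Polynomial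
  Literature.Computability.Complexity Literature.Computability.Complexity.CodeFP Literature.Computability.Complexity.LMat
  Literature.Computability.Cryptography Literature.Computability.Cryptography.GuessedCoinCall
  Literature.Computability.QuantumComplexity Literature.Computability.Cryptography.Peikert2009.Spec
  Literature.Computability.Cryptography.Regev2009

namespace MRThm59

/-! ### List primitives on codes -/

/-- `zipWith` without a context. [cite: AroraBarak2009, §1.3] -/
theorem zipWith₀ {α β γ : Type} {eα : α → List Bool} {eβ : β → List Bool} {eγ : γ → List Bool} {g : α → β → γ}
    (hg : CodeFP (pairE eα eβ) eγ (fun p => g p.1 p.2)) :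
    CodeFP (pairE (rawE eα) (rawE eβ)) (rawE eγ) (fun p => List.zipWith g p.1 p.2) :=
  ((CodeFP.zipWith (σ := Unit) (eσ := fun _ => []) (g := fun t => g t.2.1 t.2.2) (hg.comp (snd _ _) :)).comp
    ((const _ ()).pair (CodeFP.id _))).congr fun _ => rfl

/-- `addL`. [cite: AroraBarak2009, §1.3] -/
theorem addL_codeFP : CodeFP (pairE (rawE intE) (rawE intE)) (rawE intE) (fun p => addL p.1 p.2) :=
  (zipWith₀ intAdd).congr fun _ => rfl

/-- `smulL`. [cite: AroraBarak2009, §1.3] -/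
theorem smulL_codeFP : CodeFP (pairE intE (rawE intE)) (rawE intE) (fun p => smulL p.1 p.2) :=
  (CodeFP.map (σ := ℤ) (g := fun q : ℤ × ℤ => q.1 * q.2) intMul).congr fun _ => rfl

/-- `negL`. [cite: AroraBarak2009, §1.3] -/
theorem negL_codeFP : CodeFP (rawE intE) (rawE intE) negL := (CodeFP.map₀ intNeg).congr fun _ => rfl

/-- `edivL`. [cite: AroraBarak2009, §1.3] -/
theorem edivL_codeFP : CodeFP (pairE (rawE intE) intE) (rawE intE) (fun p => edivL p.1 p.2) :=
  ((CodeFP.map (σ := ℤ) (g := fun q : ℤ × ℤ => q.2 / q.1) (intEDiv.comp ((snd _ _).pair (fst _ _)))).comp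
    ((snd _ _).pair (fst _ _))).congr fun _ => rfl

/-- `mulVecL`. [cite: AroraBarak2009, §1.3] -/
theorem mulVecL_codeFP : CodeFP (pairE matE (rawE intE)) (rawE intE) (fun p => mulVecL p.1 p.2) :=
  ((CodeFP.map (σ := List ℤ) (g := fun q : List ℤ × List ℤ => dotZ q.2 q.1) (dotZ_codeFP.comp ((snd _ _).pair (fst _ _)))).comp
    ((snd _ _).pair (fst _ _))).congr fun _ => rfl

/-- The column `t` of a list of rows: `rows.map (·.getD t 0)`. [folklore] -/
theorem colOf_codeFP : CodeFP (pairE natE matE) (rawE intE) (fun p => p.2.map fun r => r.getD p.1 0) :=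
  (CodeFP.map (σ := ℕ) (g := fun q : ℕ × List ℤ => q.2.getD q.1 0)
    ((rawGetOr intE).comp ((snd _ _).pair ((fst _ _).pair (const _ (0 : ℤ)))))).congr fun _ => rfl

/-- `colCombL`. [cite: AroraBarak2009, §1.3] -/
theorem colCombL_codeFP : CodeFP (pairE unE (pairE matE (rawE intE))) (rawE intE) (fun p => colCombL p.1 p.2.1 p.2.2) := by
  have hitem : CodeFP (pairE (pairE matE (rawE intE)) natE) intE (fun q => dotZ (q.1.1.map fun r => r.getD q.2 0) q.1.2) :=
    (dotZ_codeFP.comp ((colOf_codeFP.comp ((snd _ _).pair (fst _ _).fst')).pair (fst _ _).snd') :)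
  exact ((CodeFP.map hitem).comp ((snd _ _).pair (urange.comp (fst _ _)))).congr fun p => by simp [colCombL]

/-- `transposeL`. [cite: AroraBarak2009, §1.3] -/
theorem transposeL_codeFP : CodeFP (pairE unE matE) matE (fun p => transposeL p.1 p.2) := by
  have hitem : CodeFP (pairE matE natE) (rawE intE) (fun q => q.1.map fun r => r.getD q.2 0) :=
    (colOf_codeFP.comp ((snd _ _).pair (fst _ _)) :)
  exact ((CodeFP.map hitem).comp ((snd _ _).pair (urange.comp (fst _ _)))).congr fun p => by simp [transposeL]

/-! ### The list data and the programs of `DualGridProgram` on codes -/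

/-- The tuple of the list data. [folklore] -/
def attTuple (d : AttData) : ℕ × (List (List ℤ) × (List (List ℤ) × (ℤ × (ℕ × (List (List ℤ) × (List (List ℤ) × (ℤ × ℕ))))))) :=
  (d.n, (d.Brows, (d.Gcols, (d.Dg, (d.N, (d.Srows, (d.GTcols, (d.modM, d.q))))))))

/-- The code of the tuple (`n` unary, `N`, `q` binary). [folklore] -/
abbrev attTupleE : ℕ × (List (List ℤ) × (List (List ℤ) × (ℤ × (ℕ × (List (List ℤ) × (List (List ℤ) × (ℤ × ℕ))))))) → List Bool :=
  pairE unE (pairE matE (pairE matE (pairE intE (pairE natE (pairE matE (pairE matE (pairE intE natE)))))))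

/-- **The code of the list data.** [folklore] -/
def attDE : AttData → List Bool := fun d => attTupleE (attTuple d)

/-- The list data as a tuple on codes. [folklore] -/
theorem attTup : CodeFP attDE attTupleE attTuple := transparent fun _ => rfl
/-- `n` on codes. [folklore] -/
theorem att_n : CodeFP attDE unE AttData.n := (attTup.fst' :)
/-- `Brows` on codes. [folklore] -/
theorem att_Brows : CodeFP attDE matE AttData.Brows := (attTup.snd'.fst' :)
/-- `Gcols` on codes. [folklore] -/
theorem att_Gcols : CodeFP attDE matE AttData.Gcols := (attTup.snd'.snd'.fst' :)
/-- `Dg` on codes. [folklore] -/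
theorem att_Dg : CodeFP attDE intE AttData.Dg := (attTup.snd'.snd'.snd'.fst' :)
/-- `N` on codes. [folklore] -/
theorem att_N : CodeFP attDE natE AttData.N := (attTup.snd'.snd'.snd'.snd'.fst' :)
/-- `Srows` on codes. [folklore] -/
theorem att_Srows : CodeFP attDE matE AttData.Srows := (attTup.snd'.snd'.snd'.snd'.snd'.fst' :)
/-- `GTcols` on codes. [folklore] -/
theorem att_GTcols : CodeFP attDE matE AttData.GTcols := (attTup.snd'.snd'.snd'.snd'.snd'.snd'.fst' :)
/-- `modM` on codes. [folklore] -/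
theorem att_modM : CodeFP attDE intE AttData.modM := (attTup.snd'.snd'.snd'.snd'.snd'.snd'.snd'.fst' :)
/-- `q` on codes. [folklore] -/
theorem att_q : CodeFP attDE natE AttData.q := (attTup.snd'.snd'.snd'.snd'.snd'.snd'.snd'.snd' :)

/-- `N · Dg`. [folklore] -/
theorem att_NDg : CodeFP attDE intE (fun d => (d.N : ℤ) * d.Dg) := (intMul.comp ((intOfNat.comp att_N).pair att_Dg) :)

section Programs

variable {σ : Type} {eσ : σ → List Bool}

/-- `FvecL` with the data as context. [cite: MicciancioRegev2007, Lemma 5.7] -/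
theorem FvecL_codeFP : CodeFP (pairE attDE (rawE intE)) (rawE intE) (fun p => p.1.FvecL p.2) :=
  ((edivL_codeFP.comp ((mulVecL_codeFP.comp ((att_Brows.comp (fst _ _)).pair (negL_codeFP.comp (snd _ _)))).pair
    (att_NDg.comp (fst _ _)))) :).congr fun _ => rfl

/-- `yVecL`. [cite: MicciancioRegev2007, Lemma 5.7] -/
theorem yVecL_codeFP : CodeFP (pairE attDE (rawE intE)) (rawE intE) (fun p => p.1.yVecL p.2) :=
  ((negL_codeFP.comp (colCombL_codeFP.comp ((att_n.comp (fst _ _)).pair ((att_Gcols.comp (fst _ _)).pair FvecL_codeFP)))) :).congr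
    fun _ => rfl

/-- `reduceVecL`. [cite: MicciancioRegev2007, Lemma 5.7] -/
theorem reduceVecL_codeFP : CodeFP (pairE attDE (rawE intE)) (rawE intE) (fun p => p.1.reduceVecL p.2) := by
  have hin : CodeFP (pairE attDE (rawE intE)) (rawE intE) (fun p => edivL (mulVecL p.1.Brows p.2) (p.1.N * p.1.Dg)) :=
    (edivL_codeFP.comp ((mulVecL_codeFP.comp ((att_Brows.comp (fst _ _)).pair (snd _ _))).pair (att_NDg.comp (fst _ _))) :)
  have hcc : CodeFP (pairE attDE (rawE intE)) (rawE intE) (fun p => colCombL p.1.n p.1.Gcols (edivL (mulVecL p.1.Brows p.2) (p.1.N * p.1.Dg))) :=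
    (colCombL_codeFP.comp ((att_n.comp (fst _ _)).pair ((att_Gcols.comp (fst _ _)).pair hin)) :)
  have hs : CodeFP (pairE attDE (rawE intE)) (rawE intE) (fun p => smulL p.1.N (colCombL p.1.n p.1.Gcols (edivL (mulVecL p.1.Brows p.2) (p.1.N * p.1.Dg)))) :=
    (smulL_codeFP.comp ((intOfNat.comp (att_N.comp (fst _ _))).pair hcc) :)
  exact ((addL_codeFP.comp ((snd _ _).pair (negL_codeFP.comp hs))) :).congr fun _ => rfl

/-- `crepL`. [folklore] -/
theorem crepL_codeFP : CodeFP (pairE attDE (rawE intE)) (rawE intE) (fun p => p.1.crepL p.2) :=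
  ((reduceVecL_codeFP.comp ((fst _ _).pair (negL_codeFP.comp (snd _ _)))) :).congr fun _ => rfl

/-- `VnumL`. [cite: MicciancioRegev2007, Lemma 5.8 (step 3)] -/
theorem VnumL_codeFP : CodeFP (pairE attDE (pairE (rawE intE) (rawE intE))) (rawE intE) (fun p => p.1.VnumL p.2.1 p.2.2) := by
  have hin : CodeFP (pairE attDE (pairE (rawE intE) (rawE intE))) (rawE intE)
      (fun p => addL (mulVecL p.1.Brows p.2.1) (smulL (p.1.N * p.1.Dg) p.2.2)) :=
    (addL_codeFP.comp ((mulVecL_codeFP.comp ((att_Brows.comp (fst _ _)).pair (snd _ _).fst')).pair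
      (smulL_codeFP.comp ((att_NDg.comp (fst _ _)).pair (snd _ _).snd'))) :)
  exact ((colCombL_codeFP.comp ((att_n.comp (fst _ _)).pair ((att_GTcols.comp (fst _ _)).pair hin))) :).congr fun _ => rfl

/-- Integer `emod` from `ediv`. [folklore] -/
theorem intEMod' : CodeFP (pairE intE intE) intE (fun p => p.1 % p.2) :=
  ((intSub.comp ((fst _ _).pair (intMul.comp ((snd _ _).pair intEDiv)))) :).congr fun p => (Int.emod_def p.1 p.2).symm

/-- `aRowL`. [cite: MicciancioRegev2007, Lemma 5.8 (step 3)] -/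
theorem aRowL_codeFP : CodeFP (pairE attDE (rawE intE)) (rawE intE) (fun p => p.1.aRowL p.2) := by
  -- item `j`, context `(d, V)`
  have hq : CodeFP (pairE (pairE attDE (rawE intE)) natE) intE (fun t => (t.1.1.q : ℤ)) := (intOfNat.comp (att_q.comp (fst _ _).fst') :)
  have hV : CodeFP (pairE (pairE attDE (rawE intE)) natE) intE (fun t => t.1.2.getD t.2 0) :=
    ((rawGetOr intE).comp ((fst _ _).snd'.pair ((snd _ _).pair (const _ (0 : ℤ)))) :)
  have hM : CodeFP (pairE (pairE attDE (rawE intE)) natE) intE (fun t => t.1.1.modM) := (att_modM.comp (fst _ _).fst' :)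
  have hitem : CodeFP (pairE (pairE attDE (rawE intE)) natE) intE (fun t => ((t.1.1.q : ℤ) * t.1.2.getD t.2 0 / t.1.1.modM) % t.1.1.q) :=
    (intEMod'.comp ((intEDiv.comp ((intMul.comp (hq.pair hV)).pair hM)).pair hq) :)
  exact ((CodeFP.map hitem).comp ((CodeFP.id _).pair (urange.comp (att_n.comp (fst _ _))))).congr fun p => by
    simp [AttData.aRowL]

/-- `cwL`. [cite: MicciancioRegev2007, Lemma 5.8 (ii)] -/
theorem cwL_codeFP : CodeFP (pairE attDE (pairE (rawE intE) (rawE intE))) (rawE intE) (fun p => p.1.cwL p.2.1 p.2.2) := by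
  have h1 : CodeFP (pairE attDE (pairE (rawE intE) (rawE intE))) (rawE intE) (fun p => negL (colCombL p.1.n p.1.Gcols p.2.1)) :=
    (negL_codeFP.comp (colCombL_codeFP.comp ((att_n.comp (fst _ _)).pair ((att_Gcols.comp (fst _ _)).pair (snd _ _).fst'))) :)
  have h2 : CodeFP (pairE attDE (pairE (rawE intE) (rawE intE))) (rawE intE) (fun p => colCombL p.1.n p.1.Srows (edivL p.2.2 p.1.modM)) :=
    (colCombL_codeFP.comp ((att_n.comp (fst _ _)).pair ((att_Srows.comp (fst _ _)).pair
      (edivL_codeFP.comp ((snd _ _).snd'.pair (att_modM.comp (fst _ _)))))) :)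
  exact ((addL_codeFP.comp (h1.pair h2)) :).congr fun _ => rfl

/-- `VsL`. [folklore] -/
theorem VsL_codeFP : CodeFP (pairE attDE (pairE matE matE)) matE (fun p => p.1.VsL p.2.1 p.2.2) := by
  have hg : CodeFP (pairE attDE (pairE (rawE intE) (rawE intE))) (rawE intE) (fun t => t.1.VnumL (t.1.crepL t.2.1) t.2.2) :=
    (VnumL_codeFP.comp ((fst _ _).pair ((crepL_codeFP.comp ((fst _ _).pair (snd _ _).fst')).pair (snd _ _).snd')) :)
  exact ((CodeFP.zipWith hg) :).congr fun _ => rfl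

/-- `aRowsL`. [cite: MicciancioRegev2007, Lemma 5.8 (step 3)] -/
theorem aRowsL_codeFP : CodeFP (pairE attDE (pairE matE matE)) matE (fun p => p.1.aRowsL p.2.1 p.2.2) :=
  (((CodeFP.map aRowL_codeFP).comp ((fst _ _).pair VsL_codeFP)) :).congr fun _ => rfl

/-- `uVecL`. [cite: MicciancioRegev2007, Thm. 5.9 (step 4) with Lemma 5.8 (step 5)] -/
theorem uVecL_codeFP : CodeFP (pairE attDE (pairE (pairE matE matE) (rawE intE))) (rawE intE) (fun p => p.1.uVecL p.2.1.1 p.2.1.2 p.2.2) := by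
  let iE : AttData × ((List (List ℤ) × List (List ℤ)) × List ℤ) → List Bool := pairE attDE (pairE (pairE matE matE) (rawE intE))
  have hd : CodeFP iE attDE (fun p => p.1) := fst _ _
  have hn : CodeFP iE unE (fun p => p.1.n) := (att_n.comp hd :)
  have hKs : CodeFP iE matE (fun p => p.2.1.1) := ((snd _ _).fst'.fst' :)
  have hκs : CodeFP iE matE (fun p => p.2.1.2) := ((snd _ _).fst'.snd' :)
  have hz : CodeFP iE (rawE intE) (fun p => p.2.2) := ((snd _ _).snd' :)
  have hVs : CodeFP iE matE (fun p => p.1.VsL p.2.1.1 p.2.1.2) := (VsL_codeFP.comp (hd.pair (hKs.pair hκs)) :)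
  have hcws : CodeFP iE matE (fun p => List.zipWith p.1.cwL p.2.1.2 (p.1.VsL p.2.1.1 p.2.1.2)) :=
    ((CodeFP.zipWith (σ := AttData) (g := fun t => t.1.cwL t.2.1 t.2.2) cwL_codeFP).comp (hd.pair (hκs.pair hVs)) :)
  have hA : CodeFP iE matE (fun p => p.1.aRowsL p.2.1.1 p.2.1.2) := (aRowsL_codeFP.comp (hd.pair (hKs.pair hκs)) :)
  have h1 : CodeFP iE (rawE intE) (fun p => colCombL p.1.n (List.zipWith p.1.cwL p.2.1.2 (p.1.VsL p.2.1.1 p.2.1.2)) p.2.2) :=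
    (colCombL_codeFP.comp (hn.pair (hcws.pair hz)) :)
  have h2 : CodeFP iE (rawE intE) (fun p => colCombL p.1.n p.1.Srows (edivL (colCombL p.1.n (p.1.aRowsL p.2.1.1 p.2.1.2) p.2.2) p.1.q)) :=
    (colCombL_codeFP.comp (hn.pair ((att_Srows.comp hd).pair (edivL_codeFP.comp ((colCombL_codeFP.comp (hn.pair (hA.pair hz))).pair
      (intOfNat.comp (att_q.comp hd)))))) :)
  have hys : CodeFP iE matE (fun p => p.2.1.1.map p.1.yVecL) := ((CodeFP.map yVecL_codeFP).comp (hd.pair hKs) :)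
  have h3 : CodeFP iE (rawE intE) (fun p => negL (colCombL p.1.n (p.2.1.1.map p.1.yVecL) p.2.2)) :=
    (negL_codeFP.comp (colCombL_codeFP.comp (hn.pair (hys.pair hz))) :)
  exact ((addL_codeFP.comp ((addL_codeFP.comp (h1.pair h2)).pair h3)) :).congr fun _ => rfl

end Programs


/-! ### The context on codes -/

/-- `log₂ X ≤ size X`. [folklore] -/
theorem log_two_le_size (X : ℕ) : Nat.log 2 X ≤ Nat.size X := by
  rcases Nat.eq_zero_or_pos X with rfl | hX
  · simp
  · have h1 : 2 ^ Nat.log 2 X ≤ X := Nat.pow_log_le_self 2 hX.ne'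
    have h2 : X < 2 ^ Nat.size X := Nat.lt_size_self X
    exact ((Nat.pow_lt_pow_iff_right (by norm_num)).1 (h1.trans_lt h2)).le

/-- `Int.sign` by cases. [folklore] -/
theorem intSign' : CodeFP intE intE Int.sign := by
  have h : CodeFP intE intE (fun z => if decide (z < 0) then (-1 : ℤ) else if decide (z = 0) then (0 : ℤ) else 1) :=
    ((intLt.comp ((CodeFP.id _).pair (const _ (0 : ℤ)))).ite (const _ (-1 : ℤ))
      ((intEq.comp ((CodeFP.id _).pair (const _ (0 : ℤ)))).ite (const _ (0 : ℤ)) (const _ (1 : ℤ))) :)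
  refine h.congr fun z => ?_
  rcases lt_trichotomy z 0 with hz | rfl | hz
  · simp [hz, Int.sign_eq_neg_one_of_neg hz]
  · simp
  · simp [hz.ne', not_lt.2 hz.le, Int.sign_eq_one_of_pos hz]

/-- `alphaOfNat`. [cite: MicciancioRegev2007, Thm. 5.9 (step 1)] -/
theorem alphaOfNat_codeFP : CodeFP (pairE unE natE) intE (fun p => alphaOfNat p.1 p.2) := by
  have hb : CodeFP (pairE unE natE) natE (fun p => p.1) := (natOfUn.comp (fst _ _)).congr fun _ => rfl
  have ha : CodeFP (pairE unE natE) natE (fun p => p.2) := snd _ _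
  have h : CodeFP (pairE unE natE) intE (fun p => if decide (p.2 < p.1) then ((p.2 + 1 : ℕ) : ℤ) else -(((p.2 - p.1 + 1 : ℕ) : ℤ))) :=
    ((natLt.comp (ha.pair hb)).ite (intOfNat.comp (natAdd.comp (ha.pair (const _ 1))))
      (intNeg.comp (intOfNat.comp (natAdd.comp ((natSub.comp (ha.pair hb)).pair (const _ 1))))) :)
  refine h.congr fun p => ?_
  unfold alphaOfNat
  by_cases hlt : p.2 < p.1 <;> simp [hlt]

/-- `SIS.matBound` in unary. [folklore] -/
theorem matBound_codeFP : CodeFP (pairE unE (pairE unE unE)) unE (fun p => SIS.matBound p.1 p.2.1 p.2.2) := by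
  let iE : ℕ × (ℕ × ℕ) → List Bool := pairE unE (pairE unE unE)
  have hn : CodeFP iE unE (fun p => p.1) := fst _ _
  have hm : CodeFP iE unE (fun p => p.2.1) := (snd _ _).fst'
  have hq : CodeFP iE unE (fun p => p.2.2) := (snd _ _).snd'
  have h2n2 : CodeFP iE unE (fun p => 2 * p.1 + 2) := (unAdd.comp ((unAdd.comp (hn.pair hn)).pair (const _ 2))).congr fun _ => by ring
  have h2m2 : CodeFP iE unE (fun p => 2 * p.2.1 + 2) := (unAdd.comp ((unAdd.comp (hm.pair hm)).pair (const _ 2))).congr fun _ => by ring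
  have h2q2 : CodeFP iE unE (fun p => 2 * p.2.2 + 2) := (unAdd.comp ((unAdd.comp (hq.pair hq)).pair (const _ 2))).congr fun _ => by ring
  have hin : CodeFP iE unE (fun p => 2 * p.2.1 + 2 + p.2.1 * (2 * p.2.2 + 2)) := (unAdd.comp (h2m2.pair (unMul_codeFP.comp (hm.pair h2q2))) :)
  have hrow : CodeFP iE unE (fun p => 2 * (2 * p.2.1 + 2 + p.2.1 * (2 * p.2.2 + 2)) + 2) :=
    (unAdd.comp ((unAdd.comp (hin.pair hin)).pair (const _ 2))).congr fun _ => by ring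
  have hbody : CodeFP iE unE (fun p => 2 * p.1 + 2 + p.1 * (2 * (2 * p.2.1 + 2 + p.2.1 * (2 * p.2.2 + 2)) + 2)) :=
    (unAdd.comp (h2n2.pair (unMul_codeFP.comp (hn.pair hrow))) :)
  have h := (unAdd.comp (h2n2.pair (unAdd.comp (h2m2.pair (unAdd.comp (h2q2.pair hbody))))) :)
  exact h.congr fun p => by simp only [SIS.matBound]

section CtxCodes

variable {α : Type} {eα : α → List Bool} {Jf : α → IncGDDInst} {iF : α → ℕ} {qf mf βhat : ℕ → ℕ}

/-- The fields of the instance on codes. [folklore] -/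
theorem inst_fields (hJ : CodeFP eα IncGDDInst.encode Jf) :
    CodeFP eα unE (fun a => (Jf a).n) ∧ CodeFP eα matE (fun a => (Jf a).U) ∧ CodeFP eα matE (fun a => (Jf a).V) ∧
    CodeFP eα (rawE intE) (fun a => (Jf a).tw) ∧ CodeFP eα natE (fun a => (Jf a).td) ∧
    CodeFP eα natE (fun a => (Jf a).rn) ∧ CodeFP eα natE (fun a => (Jf a).rd) := by
  have hT := (instTup.comp hJ :)
  exact ⟨(hT.fst'.fst' :), (hT.fst'.snd' :), (hT.snd'.fst' :), (hT.snd'.snd'.fst'.fst' :), (hT.snd'.snd'.fst'.snd' :),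
    (hT.snd'.snd'.snd'.fst'.fst' :), (hT.snd'.snd'.snd'.fst'.snd' :)⟩

/-- **`c = invDen(U)^{2n−2}` on codes.** [cite: Cohen1993, §2.6.3; AroraBarak2009, §1.3] -/
theorem ccOfJ_codeFP (hJ : CodeFP eα IncGDDInst.encode Jf) : CodeFP eα intE (fun a => ccOfJ (Jf a)) := by
  obtain ⟨hn, hU, -, -, -, -, -⟩ := inst_fields hJ
  have hden : CodeFP eα intE (fun a => invDen (Jf a).U) := (invDen_codeFP.comp hU :)
  have h2n : CodeFP eα unE (fun a => (Jf a).n + (Jf a).n) := (unAdd.comp (hn.pair hn) :)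
  have hexp : CodeFP eα unE (fun a => min (2 * (Jf a).n - 2) ((Jf a).n + (Jf a).n)) :=
    (unOfNatMin.comp (h2n.pair (natSub.comp ((natOfUn.comp h2n).pair (const _ 2))))).congr fun a => by
      simp only [id]; congr 1; omega
  exact ((intPow.comp (hden.pair hexp)) :).congr fun a => by
    rw [ccOfJ, min_eq_left (by omega)]

/-- **The rows of `B_U` on codes** (transpose, Cohen's inverse columns, transpose). [cite: Cohen1993, §2.6.3; AroraBarak2009, §1.3] -/
theorem BrowsOfJ_codeFP (hJ : CodeFP eα IncGDDInst.encode Jf) : CodeFP eα matE (fun a => BrowsOfJ (Jf a)) := by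
  obtain ⟨hn, hU, -, -, -, -, -⟩ := inst_fields hJ
  have hT : CodeFP eα matE (fun a => transposeL (Jf a).n (Jf a).U) := (transposeL_codeFP.comp (hn.pair hU) :)
  exact ((transposeL_codeFP.comp (hn.pair (invCols_codeFP.comp hT))) :).congr fun _ => rfl

/-- `Dg` on codes. [cite: Cohen1993, §2.6.3] -/
theorem DgOfJ_codeFP (hJ : CodeFP eα IncGDDInst.encode Jf) : CodeFP eα intE (fun a => DgOfJ (Jf a)) := ((invDen_codeFP.comp (BrowsOfJ_codeFP hJ)) :).congr fun _ => rfl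

/-- `α` on codes. [cite: MicciancioRegev2007, Thm. 5.9 (step 1)] -/
theorem alphaOfJ_codeFP (hJ : CodeFP eα IncGDDInst.encode Jf) (hi : CodeFP eα unE iF) (hβ : CodeFP unE unE βhat) :
    CodeFP eα intE (fun a => alphaOfJ βhat (Jf a) (iF a)) := by
  obtain ⟨hn, -, -, -, -, -, -⟩ := inst_fields hJ
  have hb : CodeFP eα unE (fun a => βhat (Jf a).n) := (hβ.comp hn :)
  have h2b : CodeFP eα natE (fun a => 2 * βhat (Jf a).n) := (natOfUn.comp (unAdd.comp (hb.pair hb))).congr fun a => by simp only [id]; ring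
  have hmod : CodeFP eα natE (fun a => iF a % (2 * βhat (Jf a).n)) := (natMod.comp ((natOfUn.comp hi).pair h2b) :)
  exact ((alphaOfNat_codeFP.comp (hb.pair hmod)) :).congr fun _ => rfl

/-- `j₀` on codes. [cite: MicciancioRegev2007, Thm. 5.9 (step 1)] -/
theorem j0OfJ_codeFP (hJ : CodeFP eα IncGDDInst.encode Jf) (hi : CodeFP eα unE iF) (hβ : CodeFP unE unE βhat) :
    CodeFP eα natE (fun a => j0OfJ βhat (Jf a) (iF a)) := by
  obtain ⟨hn, -, -, -, -, -, -⟩ := inst_fields hJ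
  have hb : CodeFP eα unE (fun a => βhat (Jf a).n) := (hβ.comp hn :)
  have h2b : CodeFP eα natE (fun a => 2 * βhat (Jf a).n) := (natOfUn.comp (unAdd.comp (hb.pair hb))).congr fun a => by simp only [id]; ring
  exact ((natDiv.comp ((natOfUn.comp hi).pair h2b)) :).congr fun _ => rfl

/-- `N₂ = q 2^{e(n)}` on codes (binary). [folklore] -/
theorem N2OfJ_codeFP (hJ : CodeFP eα IncGDDInst.encode Jf) (hq : CodeFP unE unE qf) : CodeFP eα natE (fun a => N2Of (qf (Jf a).n) (Jf a).n) := by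
  obtain ⟨hn, -, -, -, -, -, -⟩ := inst_fields hJ
  have he : CodeFP eα unE (fun a => eOf (Jf a).n) :=
    (unAdd.comp ((unAdd.comp (hn.pair (Peikert2009.Spec.rOfUn_codeFP.comp hn))).pair (const _ 3))).congr fun _ => rfl
  exact ((natMul.comp ((natOfUn.comp (hq.comp hn)).pair (natPow.comp ((const _ 2).pair he)))) :).congr fun _ => rfl

/-- `N₁` on codes. [folklore] -/
theorem N1OfJ_codeFP (hJ : CodeFP eα IncGDDInst.encode Jf) (hq : CodeFP unE unE qf) (hβ : CodeFP unE unE βhat) :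
    CodeFP eα natE (fun a => N1OfJ qf βhat (Jf a)) := by
  obtain ⟨hn, -, -, -, -, -, hrd⟩ := inst_fields hJ
  have hb1 : CodeFP eα natE (fun a => βhat (Jf a).n + 1) := (natOfUn.comp (unSucc.comp (hβ.comp hn))).congr fun _ => rfl
  exact ((natMul.comp ((natMul.comp ((natMul.comp ((N2OfJ_codeFP hJ hq).pair hrd)).pair hb1)).pair (natOfUn.comp hn))) :).congr
    fun _ => rfl

/-- `N` on codes. [folklore] -/
theorem NOfJ_codeFP (hJ : CodeFP eα IncGDDInst.encode Jf) (hi : CodeFP eα unE iF) (hq : CodeFP unE unE qf) (hβ : CodeFP unE unE βhat) :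
    CodeFP eα natE (fun a => NOfJ qf βhat (Jf a) (iF a)) := by
  obtain ⟨-, -, -, -, htd, -, -⟩ := inst_fields hJ
  exact ((natMul.comp ((natMul.comp ((N1OfJ_codeFP hJ hq hβ).pair (intNatAbs.comp (alphaOfJ_codeFP hJ hi hβ)))).pair htd)) :).congr
    fun _ => rfl

/-- The scaled rows on codes. [cite: MicciancioRegev2007, Thm. 5.9 (input S)] -/
theorem SrowsOfJ_codeFP (hJ : CodeFP eα IncGDDInst.encode Jf) : CodeFP eα matE (fun a => SrowsOfJ (Jf a)) := by
  obtain ⟨-, -, hV, -, -, -, -⟩ := inst_fields hJ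
  exact (((CodeFP.map (σ := ℤ) (g := fun q : ℤ × List ℤ => smulL q.1 q.2) smulL_codeFP).comp ((ccOfJ_codeFP hJ).pair hV)) :).congr
    fun _ => rfl

/-- The rows of `T_S` on codes. [cite: MicciancioRegev2007, Lemma 5.8 (S-coordinates)] -/
theorem TSrowsOfJ_codeFP (hJ : CodeFP eα IncGDDInst.encode Jf) : CodeFP eα matE (fun a => TSrowsOfJ (Jf a)) := by
  obtain ⟨hn, -, -, -, -, -, -⟩ := inst_fields hJ
  have hg : CodeFP (pairE (pairE matE intE) (rawE intE)) (rawE intE) (fun t => edivL (mulVecL t.1.1 t.2) t.1.2) :=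
    (edivL_codeFP.comp ((mulVecL_codeFP.comp ((fst _ _).fst'.pair (snd _ _))).pair (fst _ _).snd') :)
  have htaus : CodeFP eα matE (fun a => (SrowsOfJ (Jf a)).map fun s => edivL (mulVecL (BrowsOfJ (Jf a)) s) (DgOfJ (Jf a))) :=
    ((CodeFP.map hg).comp (((BrowsOfJ_codeFP hJ).pair (DgOfJ_codeFP hJ)).pair (SrowsOfJ_codeFP hJ)) :)
  exact ((transposeL_codeFP.comp (hn.pair htaus)) :).congr fun _ => rfl

/-- `dT` on codes. [folklore] -/
theorem dTOfJ_codeFP (hJ : CodeFP eα IncGDDInst.encode Jf) : CodeFP eα intE (fun a => dTOfJ (Jf a)) := ((invDen_codeFP.comp (TSrowsOfJ_codeFP hJ)) :).congr fun _ => rfl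

/-- **The list data of the model on codes.** [cite: MicciancioRegev2007, Thm. 5.9 (steps 2–4); AroraBarak2009, §1.3] -/
theorem attDataOfJ_codeFP (hJ : CodeFP eα IncGDDInst.encode Jf) (hi : CodeFP eα unE iF) (hq : CodeFP unE unE qf) (hβ : CodeFP unE unE βhat) :
    CodeFP eα attDE (fun a => attDataOfJ qf βhat (Jf a) (iF a)) := by
  obtain ⟨hn, -, -, -, -, -, -⟩ := inst_fields hJ
  have hN := NOfJ_codeFP hJ hi hq hβ
  have hB := BrowsOfJ_codeFP hJ
  have hD := DgOfJ_codeFP hJ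
  have hTS := TSrowsOfJ_codeFP hJ
  have hM : CodeFP eα intE (fun a => dTOfJ (Jf a) * ((NOfJ qf βhat (Jf a) (iF a) : ℤ) * DgOfJ (Jf a))) :=
    (intMul.comp ((dTOfJ_codeFP hJ).pair (intMul.comp ((intOfNat.comp hN).pair hD))) :)
  have h : CodeFP eα attTupleE (fun a => attTuple (attDataOfJ qf βhat (Jf a) (iF a))) :=
    ((hn.pair (hB.pair ((invCols_codeFP.comp hB).pair (hD.pair (hN.pair ((SrowsOfJ_codeFP hJ).pair ((invCols_codeFP.comp hTS).pair
      (hM.pair (natOfUn.comp (hq.comp hn)))))))))) :).congr fun _ => rfl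
  exact h.recodeOut fun _ => rfl

/-- `X` on codes. [folklore] -/
theorem XOfJ_codeFP (hJ : CodeFP eα IncGDDInst.encode Jf) (hi : CodeFP eα unE iF) (hq : CodeFP unE unE qf) (hβ : CodeFP unE unE βhat) :
    CodeFP eα natE (fun a => XOfJ qf βhat (Jf a) (iF a)) := by
  obtain ⟨-, -, -, -, htd, hrn, -⟩ := inst_fields hJ
  exact ((natMul.comp ((natMul.comp ((natMul.comp ((natMul.comp ((intToNat.comp (ccOfJ_codeFP hJ)).pair hrn)).pair
    (N2OfJ_codeFP hJ hq))).pair (intNatAbs.comp (alphaOfJ_codeFP hJ hi hβ)))).pair htd)) :).congr fun _ => rfl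

/-- The mesh exponent on codes, in unary (`log₂ X ≤ size X`). [folklore] -/
theorem bOfJ_codeFP (hJ : CodeFP eα IncGDDInst.encode Jf) (hi : CodeFP eα unE iF) (hq : CodeFP unE unE qf) (hβ : CodeFP unE unE βhat) :
    CodeFP eα unE (fun a => bOfJ qf βhat (Jf a) (iF a)) := by
  have hX := XOfJ_codeFP hJ hi hq hβ
  have hsz : CodeFP eα unE (fun a => Nat.size (XOfJ qf βhat (Jf a) (iF a))) := (natSizeU_codeFP.comp hX :)
  have hlog : CodeFP eα natE (fun a => min (List.replicate (Nat.size (XOfJ qf βhat (Jf a) (iF a))) ()).length (Nat.log 2 (XOfJ qf βhat (Jf a) (iF a)))) :=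
    (natLog2Min.comp (hX.pair (replicateUnit.comp hsz)) :)
  refine ((unOfNatMin.comp (hsz.pair hlog)) :).congr fun a => ?_
  have h := log_two_le_size (XOfJ qf βhat (Jf a) (iF a))
  rw [List.length_replicate, min_eq_right h, min_eq_left h, bOfJ]

/-- **The sampler's record on codes** (`Peikert2009.Spec.stdCtx_codeFP` at precision `prec (pS n) = precOf pS n`). [cite: AroraBarak2009, §1.3] -/
theorem PctxOfJ_codeFP (hJ : CodeFP eα IncGDDInst.encode Jf) (hi : CodeFP eα unE iF) (hq : CodeFP unE unE qf) (hβ : CodeFP unE unE βhat)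
    (pS : Polynomial ℕ) : CodeFP eα samplerCtxE (fun a => (POfJ qf βhat pS (Jf a) (iF a)).ctx) := by
  obtain ⟨hn, -, -, -, -, -, -⟩ := inst_fields hJ
  have hp : CodeFP eα unE (fun a => pS.eval (Jf a).n) := ((MRLemma510.unPoly pS).comp hn :)
  exact ((Peikert2009.Spec.stdCtx_codeFP hp (bOfJ_codeFP hJ hi hq hβ)) :).congr fun _ => rfl

/-- The sampler's coin length on codes, in unary. [cite: AroraBarak2009, §1.3] -/
theorem coinLenOfJ_codeFP (hJ : CodeFP eα IncGDDInst.encode Jf) (hi : CodeFP eα unE iF) (hq : CodeFP unE unE qf) (hβ : CodeFP unE unE βhat)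
    (pS : Polynomial ℕ) : CodeFP eα unE (fun a => (POfJ qf βhat pS (Jf a) (iF a)).coinLen) := by
  obtain ⟨hn, -, -, -, -, -, -⟩ := inst_fields hJ
  have hp : CodeFP eα unE (fun a => pS.eval (Jf a).n) := ((MRLemma510.unPoly pS).comp hn :)
  exact ((Peikert2009.Spec.stdCoinLen_codeFP hp (bOfJ_codeFP hJ hi hq hβ)) :).congr fun _ => rfl

/-- The box length on codes, in unary. [folklore] -/
theorem ellOfJ_codeFP (hJ : CodeFP eα IncGDDInst.encode Jf) : CodeFP eα unE (fun a => ellOfJ (Jf a)) := by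
  obtain ⟨hn, -, -, -, -, -, -⟩ := inst_fields hJ
  exact ((unAdd.comp ((unAdd.comp ((natSizeU_codeFP.comp (intToNat.comp (dTOfJ_codeFP hJ))).pair (natSizeU_codeFP.comp (natOfUn.comp hn)))).pair
    hn)) :).congr fun _ => rfl

/-- The coin supply `R` of the call on codes, in unary. [cite: Goldreich2001, §1.3.2] -/
theorem ROfJ_codeFP (hJ : CodeFP eα IncGDDInst.encode Jf) (hq : CodeFP unE unE qf) (hm : CodeFP unE unE mf) (pB : Polynomial ℕ) :
    CodeFP eα unE (fun a => ROfJ qf mf pB (Jf a)) := by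
  obtain ⟨hn, -, -, -, -, -, -⟩ := inst_fields hJ
  have hmb : CodeFP eα unE (fun a => SIS.matBound (Jf a).n (mf (Jf a).n) (qf (Jf a).n)) :=
    (matBound_codeFP.comp (hn.pair ((hm.comp hn).pair (hq.comp hn))) :)
  exact (((MRLemma510.unPoly pB).comp hmb) :).congr fun _ => rfl

/-- The shift row on codes. [cite: MicciancioRegev2007, Thm. 5.9 (step 2)] -/
theorem TshOfJ_codeFP (hJ : CodeFP eα IncGDDInst.encode Jf) (hi : CodeFP eα unE iF) (hq : CodeFP unE unE qf) (hβ : CodeFP unE unE βhat) :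
    CodeFP eα (rawE intE) (fun a => TshOfJ qf βhat (Jf a) (iF a)) := by
  obtain ⟨-, -, -, htw, -, -, -⟩ := inst_fields hJ
  have hk : CodeFP eα intE (fun a => -(Int.sign (alphaOfJ βhat (Jf a) (iF a)) * ccOfJ (Jf a) * N1OfJ qf βhat (Jf a))) :=
    (intNeg.comp (intMul.comp ((intMul.comp ((intSign'.comp (alphaOfJ_codeFP hJ hi hβ)).pair (ccOfJ_codeFP hJ))).pair
      (intOfNat.comp (N1OfJ_codeFP hJ hq hβ)))) :)
  exact ((smulL_codeFP.comp (hk.pair htw)) :).congr fun _ => rfl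

end CtxCodes

/-! ### The run on codes, against an abstract machine context -/

/-- **The machine context of a run**: the list data, the number of samples, the guessed position, the
shift row, the sampler's RECORD and coin length, the box length, and the two lengths of the call.
[cite: MicciancioRegev2007, Thm. 5.9 (steps 1–4)] -/
structure MCtx where
  /-- the list data -/
  d : AttData
  /-- number of samples `m` -/
  m : ℕ
  /-- guessed position `j₀` -/
  j₀ : ℕ
  /-- shift row of sample `j₀` -/
  Tsh : List ℤ
  /-- the sampler's parameter record -/
  sc : SamplerCtx
  /-- the sampler's coin length per coordinate -/
  cl : ℕ
  /-- box length `ℓ` -/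
  ℓ : ℕ
  /-- guess bits of the call -/
  W : ℕ
  /-- coin supply of the call -/
  R : ℕ

namespace MCtx

variable (c : MCtx)

/-- Coins of the noises. [folklore] -/
def len1 : ℕ := c.m * (c.d.n * c.cl)
/-- Coins of the boxes. [folklore] -/
def len2 : ℕ := c.m * (c.d.n * c.ℓ)
/-- All coins. [folklore] -/
def coinTotal : ℕ := c.len1 + c.len2 + (c.W + c.R)
/-- The noises against the record, from the first segment. [cite: MicciancioRegev2007, Thm. 5.9 (step 2)] -/
def Ks (s : List Bool) : List (List ℤ) :=
  ((blocksOf c.cl c.d.n c.m s).map fun ws => ws.map (samplerOf c.sc)).mapIdx fun i X => if i = c.j₀ then addL X c.Tsh else X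
/-- The boxes, from the second segment. [folklore] -/
def kappas (s : List Bool) : List (List ℤ) :=
  (blocksOf c.ℓ c.d.n c.m s).map fun ws => ws.map fun w => (Literature.Computability.Complexity.bitsToNat w : ℤ)
/-- The query columns. [cite: MicciancioRegev2007, Lemma 5.8 (step 3)] -/
def aRows (r : List Bool) : List (List ℤ) := c.d.aRowsL (c.Ks (r.take c.len1)) (c.kappas ((r.drop c.len1).take c.len2))
/-- The rows of residues. [cite: MicciancioRegev2007, Def. 5.3] -/
def valRows (r : List Bool) : List (List ℕ) := (List.range c.d.n).map fun j => (c.aRows r).map fun col => (col.getD j 0).toNat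
/-- The query string. [cite: MicciancioRegev2007, Def. 5.3] -/
def query (r : List Bool) : List Bool := pairE natE (pairE natE (pairE natE (listE (listE natE)))) (c.d.n, (c.m, (c.d.q, c.valRows r)))
/-- The answer of the solver. [cite: Goldreich2001, §1.3.2] -/
def zAns (B : RandAlg (List Bool) (List Bool)) (r : List Bool) : List ℤ :=
  GIVPPost.readVec c.m (callRun B c.W c.R (c.query r) (r.drop (c.len1 + c.len2)))
/-- The output. [cite: MicciancioRegev2007, Thm. 5.9 (output s)] -/
def runOut (B : RandAlg (List Bool) (List Bool)) (r : List Bool) : List Bool :=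
  rawE intE (edivL (mulVecL c.d.Brows (c.d.uVecL (c.Ks (r.take c.len1)) (c.kappas ((r.drop c.len1).take c.len2)) (c.zAns B r))) c.d.Dg)

/-- The tuple of a machine context. [folklore] -/
def tuple : AttData × (ℕ × (ℕ × (List ℤ × (SamplerCtx × (ℕ × (ℕ × (ℕ × ℕ))))))) :=
  (c.d, (c.m, (c.j₀, (c.Tsh, (c.sc, (c.cl, (c.ℓ, (c.W, c.R))))))))

/-- The code of the tuple. [folklore] -/
abbrev tupleE : AttData × (ℕ × (ℕ × (List ℤ × (SamplerCtx × (ℕ × (ℕ × (ℕ × ℕ))))))) → List Bool :=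
  pairE attDE (pairE unE (pairE natE (pairE (rawE intE) (pairE samplerCtxE (pairE unE (pairE unE (pairE unE unE)))))))

end MCtx

/-- **The code of a machine context.** [folklore] -/
def mctxE : MCtx → List Bool := fun c => MCtx.tupleE c.tuple

/-- The machine context as a tuple on codes. [folklore] -/
theorem mcTup : CodeFP mctxE MCtx.tupleE MCtx.tuple := transparent fun _ => rfl
/-- `d` on codes. [folklore] -/
theorem mc_d : CodeFP mctxE attDE MCtx.d := (mcTup.fst' :)
/-- `m` on codes. [folklore] -/
theorem mc_m : CodeFP mctxE unE MCtx.m := (mcTup.snd'.fst' :)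
/-- `j₀` on codes. [folklore] -/
theorem mc_j₀ : CodeFP mctxE natE MCtx.j₀ := (mcTup.snd'.snd'.fst' :)
/-- `Tsh` on codes. [folklore] -/
theorem mc_Tsh : CodeFP mctxE (rawE intE) MCtx.Tsh := (mcTup.snd'.snd'.snd'.fst' :)
/-- `sc` on codes. [folklore] -/
theorem mc_sc : CodeFP mctxE samplerCtxE MCtx.sc := (mcTup.snd'.snd'.snd'.snd'.fst' :)
/-- `cl` on codes. [folklore] -/
theorem mc_cl : CodeFP mctxE unE MCtx.cl := (mcTup.snd'.snd'.snd'.snd'.snd'.fst' :)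
/-- `ℓ` on codes. [folklore] -/
theorem mc_ℓ : CodeFP mctxE unE MCtx.ℓ := (mcTup.snd'.snd'.snd'.snd'.snd'.snd'.fst' :)
/-- `W` on codes. [folklore] -/
theorem mc_W : CodeFP mctxE unE MCtx.W := (mcTup.snd'.snd'.snd'.snd'.snd'.snd'.snd'.fst' :)
/-- `R` on codes. [folklore] -/
theorem mc_R : CodeFP mctxE unE MCtx.R := (mcTup.snd'.snd'.snd'.snd'.snd'.snd'.snd'.snd' :)
/-- `d.n` on codes. [folklore] -/
theorem mc_n : CodeFP mctxE unE (fun c => c.d.n) := (att_n.comp mc_d :)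
/-- `len1` on codes. [folklore] -/
theorem mc_len1 : CodeFP mctxE unE MCtx.len1 := ((unMul_codeFP.comp (mc_m.pair (unMul_codeFP.comp (mc_n.pair mc_cl)))) :).congr fun _ => rfl
/-- `len2` on codes. [folklore] -/
theorem mc_len2 : CodeFP mctxE unE MCtx.len2 := ((unMul_codeFP.comp (mc_m.pair (unMul_codeFP.comp (mc_n.pair mc_ℓ)))) :).congr fun _ => rfl

/-- **Coin blocks** `blocksOf K k₀ T s` on codes (`K, k₀, T` unary; two nested `strChunks`). [cite: AroraBarak2009, §1.3] -/
theorem blocksOf_codeFP' : CodeFP (pairE (pairE unE (pairE unE unE)) strE) (rawE (rawE strE)) (fun p => blocksOf p.1.1 p.1.2.1 p.1.2.2 p.2) := by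
  let iE : (ℕ × (ℕ × ℕ)) × List Bool → List Bool := pairE (pairE unE (pairE unE unE)) strE
  have hK : CodeFP iE unE (fun p => p.1.1) := (fst _ _).fst'
  have hk : CodeFP iE unE (fun p => p.1.2.1) := (fst _ _).snd'.fst'
  have hT : CodeFP iE unE (fun p => p.1.2.2) := (fst _ _).snd'.snd'
  have hr : CodeFP iE strE (fun p => p.2) := snd _ _
  have hbig : CodeFP iE (rawE strE) (fun p => (List.range p.1.2.2).map fun j => (p.2.drop (j * (p.1.1 * p.1.2.1))).take (p.1.1 * p.1.2.1)) :=
    (strChunks.comp (hT.pair ((unMul_codeFP.comp (hK.pair hk)).pair hr)) :)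
  have hitem : CodeFP (pairE (pairE unE unE) strE) (rawE strE) (fun q => (List.range q.1.1).map fun l => (q.2.drop (l * q.1.2)).take q.1.2) :=
    (strChunks.comp ((fst _ _).fst'.pair ((fst _ _).snd'.pair (snd _ _))) :)
  refine (((CodeFP.map hitem).comp ((hk.pair hK).pair hbig)) :).congr fun p => ?_
  simp only [blocksOf, Literature.Computability.Cryptography.chunk, List.map_map, Function.comp_def]
  refine List.map_congr_left fun j _ => List.map_congr_left fun l _ => ?_
  rw [Nat.mul_comm j, Nat.mul_comm l]

/-- **The noises on codes.** [cite: MicciancioRegev2007, Thm. 5.9 (step 2); AroraBarak2009, §1.3] -/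
theorem mcKs_codeFP : CodeFP (pairE mctxE strE) matE (fun p => p.1.Ks p.2) := by
  let iE : MCtx × List Bool → List Bool := pairE mctxE strE
  have hc : CodeFP iE mctxE (fun p => p.1) := fst _ _
  have hblk : CodeFP iE (rawE (rawE strE)) (fun p => blocksOf p.1.cl p.1.d.n p.1.m p.2) :=
    (blocksOf_codeFP'.comp ((((mc_cl.comp hc).pair ((mc_n.comp hc).pair (mc_m.comp hc))) :).pair (snd _ _)) :)
  have hsamp : CodeFP (pairE samplerCtxE (rawE strE)) (rawE intE) (fun t => t.2.map (samplerOf t.1)) :=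
    (CodeFP.map (σ := SamplerCtx) (g := fun q : SamplerCtx × List Bool => samplerOf q.1 q.2) samplerOf_codeFP).congr fun _ => rfl
  have hXs : CodeFP iE matE (fun p => (blocksOf p.1.cl p.1.d.n p.1.m p.2).map fun ws => ws.map (samplerOf p.1.sc)) :=
    ((CodeFP.map (σ := SamplerCtx) (g := fun t : SamplerCtx × List (List Bool) => t.2.map (samplerOf t.1)) hsamp).comp
      ((mc_sc.comp hc).pair hblk) :)
  have hg : CodeFP (pairE (pairE natE (rawE intE)) (pairE natE (rawE intE))) (rawE intE)
      (fun t => if decide (t.2.1 = t.1.1) then addL t.2.2 t.1.2 else t.2.2) :=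
    ((natEq.comp ((snd _ _).fst'.pair (fst _ _).fst')).ite (addL_codeFP.comp ((snd _ _).snd'.pair (fst _ _).snd')) (snd _ _).snd' :)
  refine (((CodeFP.mapIdx hg).comp ((((mc_j₀.comp hc).pair (mc_Tsh.comp hc)) :).pair hXs)) :).congr fun p => ?_
  simp only [MCtx.Ks, decide_eq_true_eq]

/-- **The boxes on codes.** [folklore] -/
theorem mcKappas_codeFP : CodeFP (pairE mctxE strE) matE (fun p => p.1.kappas p.2) := by
  let iE : MCtx × List Bool → List Bool := pairE mctxE strE
  have hc : CodeFP iE mctxE (fun p => p.1) := fst _ _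
  have hblk : CodeFP iE (rawE (rawE strE)) (fun p => blocksOf p.1.ℓ p.1.d.n p.1.m p.2) :=
    (blocksOf_codeFP'.comp ((((mc_ℓ.comp hc).pair ((mc_n.comp hc).pair (mc_m.comp hc))) :).pair (snd _ _)) :)
  have hval : CodeFP strE intE (fun w => (Literature.Computability.Complexity.bitsToNat w : ℤ)) := (intOfNat.comp strVal :)
  exact (((CodeFP.map₀ (CodeFP.map₀ hval)).comp hblk) :).congr fun _ => rfl

/-- **The query columns on codes.** [cite: MicciancioRegev2007, Lemma 5.8 (step 3)] -/
theorem mcARows_codeFP : CodeFP (pairE mctxE strE) matE (fun p => p.1.aRows p.2) := by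
  let iE : MCtx × List Bool → List Bool := pairE mctxE strE
  have hc : CodeFP iE mctxE (fun p => p.1) := fst _ _
  have hs1 : CodeFP iE strE (fun p => p.2.take p.1.len1) := (strTake.comp ((mc_len1.comp hc).pair (snd _ _)) :)
  have hs2 : CodeFP iE strE (fun p => (p.2.drop p.1.len1).take p.1.len2) :=
    (strTake.comp ((mc_len2.comp hc).pair (strDrop.comp ((mc_len1.comp hc).pair (snd _ _)))) :)
  exact ((aRowsL_codeFP.comp ((mc_d.comp hc).pair ((mcKs_codeFP.comp (hc.pair hs1)).pair (mcKappas_codeFP.comp (hc.pair hs2))))) :).congr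
    fun _ => rfl

/-- **The query string on codes** (`encodeMatrix A` assembled from the rows of residues). [cite: MicciancioRegev2007, Def. 5.3; AroraBarak2009, §1.3] -/
theorem mcQuery_codeFP : CodeFP (pairE mctxE strE) strE (fun p => p.1.query p.2) := by
  let iE : MCtx × List Bool → List Bool := pairE mctxE strE
  have hc : CodeFP iE mctxE (fun p => p.1) := fst _ _
  have hent : CodeFP (pairE natE (rawE intE)) natE (fun t => (t.2.getD t.1 0).toNat) :=
    (intToNat.comp ((rawGetOr intE).comp ((snd _ _).pair ((fst _ _).pair (const _ (0 : ℤ))))) :)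
  have hrow : CodeFP (pairE matE natE) (rawE natE) (fun t => t.1.map fun col => (col.getD t.2 0).toNat) :=
    ((CodeFP.map (σ := ℕ) (g := fun t : ℕ × List ℤ => (t.2.getD t.1 0).toNat) hent).comp ((snd _ _).pair (fst _ _)) :)
  have hval : CodeFP iE (rawE (rawE natE)) (fun p => p.1.valRows p.2) :=
    (((CodeFP.map (σ := List (List ℤ)) (g := fun t : List (List ℤ) × ℕ => t.1.map fun col => (col.getD t.2 0).toNat) hrow).comp
      (mcARows_codeFP.pair (urange.comp (mc_n.comp hc)))) :).congr fun _ => rfl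
  have hlist : CodeFP (rawE (rawE natE)) (listE (listE natE)) id :=
    ((listOfRaw (listE natE)).comp (CodeFP.map₀ (listOfRaw natE))).congr fun l => by simp
  have htup : CodeFP iE (pairE natE (pairE natE (pairE natE (listE (listE natE))))) (fun p => (p.1.d.n, (p.1.m, (p.1.d.q, p.1.valRows p.2)))) :=
    ((natOfUn.comp (mc_n.comp hc)).pair ((natOfUn.comp (mc_m.comp hc)).pair ((att_q.comp (mc_d.comp hc)).pair (hlist.comp hval))) :)
  exact htup.recodeOut fun _ => rfl

/-- **The solver's answer on codes** (guessed-coin call on the third segment, total decoder). [cite: Goldreich2001, §1.3.2; AroraBarak2009, §1.3] -/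
theorem mcZAns_codeFP {B : RandAlg (List Bool) (List Bool)} (hB : IsPPT B id) : CodeFP (pairE mctxE strE) (rawE intE) (fun p => p.1.zAns B p.2) := by
  let iE : MCtx × List Bool → List Bool := pairE mctxE strE
  have hc : CodeFP iE mctxE (fun p => p.1) := fst _ _
  have hs3 : CodeFP iE strE (fun p => p.2.drop (p.1.len1 + p.1.len2)) :=
    (strDrop.comp ((unAdd.comp ((mc_len1.comp hc).pair (mc_len2.comp hc))).pair (snd _ _)) :)
  have hcall : CodeFP iE strE (fun p => callRun B p.1.W p.1.R (p.1.query p.2) (p.2.drop (p.1.len1 + p.1.len2))) :=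
    ((callRun_codeFP hB).comp (((mc_W.comp hc).pair (mc_R.comp hc)).pair (mcQuery_codeFP.pair hs3)) :)
  exact ((GIVPPost.readVec_codeFP.comp ((mc_m.comp hc).pair hcall)) :).congr fun _ => rfl

/-- **The output of the run on codes.** [cite: MicciancioRegev2007, Thm. 5.9; AroraBarak2009, §1.3] -/
theorem mcRunOut_codeFP {B : RandAlg (List Bool) (List Bool)} (hB : IsPPT B id) : CodeFP (pairE mctxE strE) strE (fun p => p.1.runOut B p.2) := by
  let iE : MCtx × List Bool → List Bool := pairE mctxE strE
  have hc : CodeFP iE mctxE (fun p => p.1) := fst _ _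
  have hs1 : CodeFP iE strE (fun p => p.2.take p.1.len1) := (strTake.comp ((mc_len1.comp hc).pair (snd _ _)) :)
  have hs2 : CodeFP iE strE (fun p => (p.2.drop p.1.len1).take p.1.len2) :=
    (strTake.comp ((mc_len2.comp hc).pair (strDrop.comp ((mc_len1.comp hc).pair (snd _ _)))) :)
  have hu : CodeFP iE (rawE intE) (fun p => p.1.d.uVecL (p.1.Ks (p.2.take p.1.len1)) (p.1.kappas ((p.2.drop p.1.len1).take p.1.len2)) (p.1.zAns B p.2)) :=
    (uVecL_codeFP.comp ((mc_d.comp hc).pair (((mcKs_codeFP.comp (hc.pair hs1)).pair (mcKappas_codeFP.comp (hc.pair hs2))).pair (mcZAns_codeFP hB))) :)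
  have hout : CodeFP iE (rawE intE) (fun p => edivL (mulVecL p.1.d.Brows (p.1.d.uVecL (p.1.Ks (p.2.take p.1.len1))
      (p.1.kappas ((p.2.drop p.1.len1).take p.1.len2)) (p.1.zAns B p.2))) p.1.d.Dg) :=
    (edivL_codeFP.comp ((mulVecL_codeFP.comp ((att_Brows.comp (mc_d.comp hc)).pair hu)).pair (att_Dg.comp (mc_d.comp hc))) :)
  exact hout.recodeOut fun _ => rfl

/-- **The coin count on codes, in unary.** [folklore] -/
theorem mcCoinTotal_codeFP : CodeFP mctxE unE MCtx.coinTotal :=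
  ((unAdd.comp ((unAdd.comp (mc_len1.pair mc_len2)).pair (unAdd.comp (mc_W.pair mc_R)))) :).congr fun _ => rfl

/-! ### The machine context of `(J, i)` and its agreement with `ctxOf` -/

section MCtxOfJ

variable (qf mf βhat : ℕ → ℕ) (pS pB : Polynomial ℕ)

/-- **The machine context computed from `(J, i)`**: the components of `ctxOf` with the sampler's record
and coin length in place of its parameters. [cite: MicciancioRegev2007, Thm. 5.9 (steps 1–2)] -/
def mctxOf (J : IncGDDInst) (i : ℕ) : MCtx :=
  ⟨attDataOfJ qf βhat J i, mf J.n, j0OfJ βhat J i, TshOfJ qf βhat J i, (POfJ qf βhat pS J i).ctx, (POfJ qf βhat pS J i).coinLen,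
    ellOfJ J, Nat.size (ROfJ qf mf pB J), ROfJ qf mf pB J⟩

variable {qf mf βhat pS pB}

/-- **The machine run is the run of `ctxOf`** (the record's sampler is the flat sampler, `samplerOf_ctx`; the
decoder's closed form, `readVec_eq_ofFn_decodeIntVec`). [folklore] -/
theorem runOut_mctxOf (B : RandAlg (List Bool) (List Bool)) (J : IncGDDInst) (i : ℕ) (r : List Bool) :
    (mctxOf qf mf βhat pS pB J i).runOut B r = (ctxOf qf mf βhat pS pB J i).runOut B r := by
  have hs : samplerOf (POfJ qf βhat pS J i).ctx = (POfJ qf βhat pS J i).samplerFlat := funext (samplerOf_ctx _)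
  have hKs : (mctxOf qf mf βhat pS pB J i).Ks (r.take (mctxOf qf mf βhat pS pB J i).len1) = (ctxOf qf mf βhat pS pB J i).Ks r := by
    simp only [MCtx.Ks, RunCtx.Ks, RunCtx.Xs, mctxOf, hs]
    rfl
  have hκ : (mctxOf qf mf βhat pS pB J i).kappas ((r.drop (mctxOf qf mf βhat pS pB J i).len1).take (mctxOf qf mf βhat pS pB J i).len2) =
      (ctxOf qf mf βhat pS pB J i).kappas r := rfl
  have hA : (mctxOf qf mf βhat pS pB J i).aRows r = (ctxOf qf mf βhat pS pB J i).aRows r := by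
    rw [MCtx.aRows, hKs, hκ]; rfl
  have hQ : (mctxOf qf mf βhat pS pB J i).query r = (ctxOf qf mf βhat pS pB J i).query r := by
    rw [MCtx.query, RunCtx.query, MCtx.valRows, RunCtx.valRows, hA]; rfl
  have hZ : (mctxOf qf mf βhat pS pB J i).zAns B r = (ctxOf qf mf βhat pS pB J i).zAns B r := by
    rw [MCtx.zAns, RunCtx.zAns, GIVPPost.readVec_eq_ofFn_decodeIntVec, hQ]; rfl
  rw [MCtx.runOut, RunCtx.runOut, RunCtx.uOut, hKs, hκ, hZ]
  rfl

/-- The machine context's coin count is `coinTotal` of `ctxOf`. [folklore] -/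
theorem coinTotal_mctxOf (J : IncGDDInst) (i : ℕ) : (mctxOf qf mf βhat pS pB J i).coinTotal = (ctxOf qf mf βhat pS pB J i).coinTotal := rfl

variable {α : Type} {eα : α → List Bool} {Jf : α → IncGDDInst} {iF : α → ℕ}

/-- **The machine context of `(J, i)` on codes.** [cite: MicciancioRegev2007, Thm. 5.9 (steps 1–2); AroraBarak2009, §1.3] -/
theorem mctxOf_codeFP (hJ : CodeFP eα IncGDDInst.encode Jf) (hi : CodeFP eα unE iF) (hq : CodeFP unE unE qf) (hm : CodeFP unE unE mf)
    (hβ : CodeFP unE unE βhat) (pS pB : Polynomial ℕ) : CodeFP eα mctxE (fun a => mctxOf qf mf βhat pS pB (Jf a) (iF a)) := by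
  obtain ⟨hn, -, -, -, -, -, -⟩ := inst_fields hJ
  have hR := ROfJ_codeFP hJ hq hm pB
  have hW : CodeFP eα unE (fun a => Nat.size (ROfJ qf mf pB (Jf a))) := (natSizeU_codeFP.comp (natOfUn.comp hR) :)
  have h : CodeFP eα MCtx.tupleE (fun a => (mctxOf qf mf βhat pS pB (Jf a) (iF a)).tuple) :=
    (((attDataOfJ_codeFP hJ hi hq hβ).pair ((hm.comp hn).pair ((j0OfJ_codeFP hJ hi hβ).pair ((TshOfJ_codeFP hJ hi hq hβ).pair
      ((PctxOfJ_codeFP hJ hi hq hβ pS).pair ((coinLenOfJ_codeFP hJ hi hq hβ pS).pair ((ellOfJ_codeFP hJ).pair (hW.pair hR)))))))) :).congr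
      fun _ => rfl
  exact h.recodeOut fun _ => rfl

end MCtxOfJ

/-! ### The attempt machine -/

section Machine

variable {qf mf βhat : ℕ → ℕ} (hq : CodeFP unE unE qf) (hm : CodeFP unE unE mf) (hβ : CodeFP unE unE βhat)
  (pS pB : Polynomial ℕ) (B : RandAlg (List Bool) (List Bool)) (hB : IsPPT B id)

/-- The code of the proper input `⟨J, ⟨1ⁱ, w⟩⟩`. [folklore] -/
abbrev inE : IncGDDInst × (ℕ × List Bool) → List Bool := pairE IncGDDInst.encode (pairE unE strE)

include hq hm hβ hB in
/-- **The run on the code of `(⟨J, ⟨1ⁱ, w⟩⟩, coins)` is typed polynomial time.** [cite: MicciancioRegev2007, Thm. 5.9; AroraBarak2009, §1.3] -/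
theorem runOut_codeFP : CodeFP (pairE inE strE) strE (fun p => (ctxOf qf mf βhat pS pB p.1.1 p.1.2.1).runOut B p.2) :=
  (((mcRunOut_codeFP hB).comp ((mctxOf_codeFP (eα := pairE inE strE) ((fst _ _).fst' :) ((fst _ _).snd'.fst' :) hq hm hβ pS pB).pair
    (snd _ _))) :).congr fun _ => runOut_mctxOf B _ _ _

include hq hm hβ in
/-- **A polynomial bound on the coins a run reads, in the length of the proper input.** [cite: AroraBarak2009, §1.3] -/
theorem exists_poly_coinTotal_le :
    ∃ pA : Polynomial ℕ, ∀ (J : IncGDDInst) (i : ℕ) (w : List Bool),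
      (ctxOf qf mf βhat pS pB J i).coinTotal ≤ pA.eval (boolPair J.encode (boolPair (unE i) w)).length := by
  obtain ⟨F, hF, hFeq⟩ := (((mcCoinTotal_codeFP.comp (mctxOf_codeFP (eα := inE) (Jf := fun x => x.1) (iF := fun x => x.2.1)
    (fst _ _ :) ((snd _ _).fst' :) hq hm hβ pS pB)) :).congr fun x => coinTotal_mctxOf (qf := qf) (mf := mf) (βhat := βhat) (pS := pS) (pB := pB) x.1 x.2.1)
  obtain ⟨P, hP⟩ := exists_poly_length_le_of_mem_FP hF
  refine ⟨P, fun J i w => ?_⟩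
  have h := hP (inE (J, (i, w)))
  rw [hFeq (J, (i, w)), length_unE] at h
  exact h

/-- The shift family of the model as an `ite` on the guessed position. [folklore] -/
theorem ite_TshOf_eq (J : IncGDDInst) {m : ℕ} (j₀ : Fin m) (α : ℤ) (N₁ : ℕ) :
    (fun i : Fin m => if (i : ℕ) = (j₀ : ℕ) then TshOf J m ⟨j₀, j₀.2⟩ α N₁ ⟨j₀, j₀.2⟩ else 0) = TshOf J m j₀ α N₁ := by
  funext i
  by_cases h : i = j₀
  · subst h; funext t; simp [TshOf]
  · have h' : (i : ℕ) ≠ (j₀ : ℕ) := fun e => h (Fin.ext e)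
    funext t; simp [TshOf, h, h']

/-- The output map of the law of the run is `rawE intE ∘ zOf J`. [folklore] -/
theorem out_eq_zOf (J : IncGDDInst) :
    (fun u : Fin J.n → ℤ => rawE intE (edivL (mulVecL (rowsOf (BU (Umat J))) (vecL u)) (Dg (BU (Umat J))))) = fun u => rawE intE (zOf J u) := by
  funext u; rw [mulVecL_rowsOf, edivL_vecL]; rfl

/-- **The law of the run on the input `⟨J, ⟨1ⁱ, w⟩⟩`, `i = guessIdx β̂ j₀ a`**, in the form of the hypothesis
`hlaw` of `MRThm59Attempt.attempt_success_of_law`. [cite: MicciancioRegev2007, Thm. 5.9 (proof, steps 1–4)] -/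
theorem map_runOut_ctxOf_eq [∀ n, NeZero (qf n)] {J : IncGDDInst} (hJ : J.WellFormed) (j₀ : Fin (mf J.n)) (a : Fin (2 * βhat J.n))
    {C : ℕ} (hC : (ctxOf qf mf βhat pS pB J (guessIdx (βhat J.n) j₀ a)).coinTotal ≤ C) :
    (uniformOfFintype (List.Vector Bool C)).map (fun r => (ctxOf qf mf βhat pS pB J (guessIdx (βhat J.n) j₀ a)).runOut B r.toList) =
      (naturalAttemptWith (BU (Umat J)) (NOf J (alphaOf (βhat J.n) a) (N1Of J (qf J.n) (βhat J.n + 1))) (Smod J)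
          (PGParams.std (precOf pS J.n) (bOf J (qf J.n) (alphaOf (βhat J.n) a))).lawPMF
          (decKernel fun A : Matrix (Fin J.n) (Fin (mf J.n)) (ZMod (qf J.n)) =>
            callLaw B (Nat.size (pB.eval (SIS.matBound J.n (mf J.n) (qf J.n)))) (pB.eval (SIS.matBound J.n (mf J.n) (qf J.n))) (SIS.encodeMatrix A))
          (TshOf J (mf J.n) j₀ (alphaOf (βhat J.n) a) (N1Of J (qf J.n) (βhat J.n + 1))) (ellOf J)).map
        fun u => rawE intE (zOf J u) := by
  have hd := ctxOf_d (qf := qf) (mf := mf) (pS := pS) (pB := pB) hJ (j₀ : ℕ) a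
  have hT := ctxOf_Tsh (qf := qf) (mf := mf) (pS := pS) (pB := pB) hJ j₀.2 a
  have key := map_runOut_eq_naturalAttemptWith (q := qf J.n) hd hT B hC
  refine key.trans ?_
  have hP := ctxOf_P (qf := qf) (mf := mf) (pS := pS) (pB := pB) hJ (j₀ : ℕ) a
  have hℓ := ctxOf_ell (qf := qf) (mf := mf) (pS := pS) (pB := pB) hJ (j₀ : ℕ) a
  obtain ⟨-, hcj, -, -⟩ := ctxOf_fields (qf := qf) (mf := mf) (pS := pS) (pB := pB) J (j₀ : ℕ) a
  have hTsh : (fun i : Fin (mf J.n) => if (i : ℕ) = (ctxOf qf mf βhat pS pB J (guessIdx (βhat J.n) j₀ a)).j₀ then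
      TshOf J (mf J.n) ⟨j₀, j₀.2⟩ (alphaOf (βhat J.n) a) (N1Of J (qf J.n) (βhat J.n + 1)) ⟨j₀, j₀.2⟩ else 0) =
      TshOf J (mf J.n) j₀ (alphaOf (βhat J.n) a) (N1Of J (qf J.n) (βhat J.n + 1)) := by
    rw [hcj]; exact ite_TshOf_eq J j₀ _ _
  rw [hP, hℓ]
  exact congrArg₂ (fun (T : Fin (mf J.n) → Fin J.n → ℤ) (f : (Fin J.n → ℤ) → List Bool) =>
    (naturalAttemptWith (q := qf J.n) (BU (Umat J)) (NOf J (alphaOf (βhat J.n) a) (N1Of J (qf J.n) (βhat J.n + 1))) (Smod J)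
      (PGParams.std (precOf pS J.n) (bOf J (qf J.n) (alphaOf (βhat J.n) a))).lawPMF
      (decKernel fun A : Matrix (Fin J.n) (Fin (mf J.n)) (ZMod (qf J.n)) =>
        callLaw B (Nat.size (pB.eval (SIS.matBound J.n (mf J.n) (qf J.n)))) (pB.eval (SIS.matBound J.n (mf J.n) (qf J.n))) (SIS.encodeMatrix A))
      T (ellOf J)).map f) hTsh (out_eq_zOf J)

include hq hm hβ hB in
/-- **The attempt machine exists**: a PPT `Att` with a polynomial coin budget whose output law on
`⟨J, ⟨1ⁱ, w⟩⟩`, `i = guessIdx β̂ j₀ a`, for a well-formed `J`, is the fine-grid model of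
`DualGridAttemptSuccess` on `B_U` with the machine's parameters, the coin-driven sampler
`std (precOf pS n) b` and the guessed-coin oracle kernel, read through `zOf J` — the hypothesis `hlaw`
of `MRThm59Attempt.attempt_success_of_law`.
[cite: MicciancioRegev2007, Thm. 5.9 (the reduction, steps 1–4); AroraBarak2009, Def. 7.1] -/
theorem exists_attMachine [∀ n, NeZero (qf n)] :
    ∃ Att : RandAlg (List Bool) (List Bool), IsPPT Att id ∧ (∃ pA : Polynomial ℕ, ∀ k, Att.coinLen k = pA.eval k) ∧
      ∀ J : IncGDDInst, J.WellFormed → ∀ (j₀ : Fin (mf J.n)) (a : Fin (2 * βhat J.n)) (w : List Bool),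
        Att.outputPMF id (boolPair J.encode (boolPair (unE (guessIdx (βhat J.n) j₀ a)) w)) =
          (naturalAttemptWith (BU (Umat J)) (NOf J (alphaOf (βhat J.n) a) (N1Of J (qf J.n) (βhat J.n + 1))) (Smod J)
              (PGParams.std (precOf pS J.n) (bOf J (qf J.n) (alphaOf (βhat J.n) a))).lawPMF
              (decKernel fun A : Matrix (Fin J.n) (Fin (mf J.n)) (ZMod (qf J.n)) =>
                callLaw B (Nat.size (pB.eval (SIS.matBound J.n (mf J.n) (qf J.n)))) (pB.eval (SIS.matBound J.n (mf J.n) (qf J.n))) (SIS.encodeMatrix A))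
              (TshOf J (mf J.n) j₀ (alphaOf (βhat J.n) a) (N1Of J (qf J.n) (βhat J.n + 1))) (ellOf J)).map
            fun u => rawE intE (zOf J u) := by
  obtain ⟨F, hF, hFeq⟩ := runOut_codeFP hq hm hβ pS pB B hB
  obtain ⟨pA, hpA⟩ := exists_poly_coinTotal_le hq hm hβ pS pB
  let Att : RandAlg (List Bool) (List Bool) := ⟨fun x r => F (boolPair x r), fun k => pA.eval k⟩
  refine ⟨Att, ⟨?_, ⟨pA, fun k => le_rfl⟩⟩, ⟨pA, fun _ => rfl⟩, fun J hJ j₀ a w => ?_⟩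
  · obtain ⟨pc, Mc, hM⟩ := hF
    exact ⟨pc, Mc, fun z => hM (boolPair z.1 z.2)⟩
  have hrun : ∀ r : List Bool, Att.run (boolPair J.encode (boolPair (unE (guessIdx (βhat J.n) j₀ a)) w)) r =
      (ctxOf qf mf βhat pS pB J (guessIdx (βhat J.n) j₀ a)).runOut B r := fun r => hFeq ((J, (guessIdx (βhat J.n) j₀ a, w)), r)
  have hC : (ctxOf qf mf βhat pS pB J (guessIdx (βhat J.n) j₀ a)).coinTotal ≤
      Att.coinLen (id (boolPair J.encode (boolPair (unE (guessIdx (βhat J.n) j₀ a)) w))).length := hpA J _ w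
  rw [RandAlg.outputPMF]
  simp only [hrun]
  exact map_runOut_ctxOf_eq pS pB B hJ j₀ a hC

end Machine


/-! ### `H59a`: the machine-level attempt of MR07 Thm. 5.9 -/

section Final

open Literature.Computability.Cryptography.LWE Literature.Computability.Cryptography.LWE.RegevReduction
  Literature.Computability.Cryptography.SIS MeasureTheory _root_.Computability
open scoped ENNReal

/-- Pointwise domination preserves polynomial boundedness. [folklore] -/
private theorem isPolyBounded_of_le'' {f g : ℕ → ℕ} (hg : IsPolyBounded g) (h : ∀ n, f n ≤ g n) : IsPolyBounded f := by
  obtain ⟨p, hp⟩ := hg; exact ⟨p, fun n => (h n).trans (hp n)⟩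

/-- Sums of polynomially bounded functions. [folklore] -/
private theorem isPolyBounded_add'' {f g : ℕ → ℕ} (hf : IsPolyBounded f) (hg : IsPolyBounded g) : IsPolyBounded fun n => f n + g n := by
  obtain ⟨p, hp⟩ := hf; obtain ⟨q, hq⟩ := hg
  exact ⟨p + q, fun n => by rw [eval_add]; exact Nat.add_le_add (hp n) (hq n)⟩

/-- Products of polynomially bounded functions. [folklore] -/
private theorem isPolyBounded_mul'' {f g : ℕ → ℕ} (hf : IsPolyBounded f) (hg : IsPolyBounded g) : IsPolyBounded fun n => f n * g n := by
  obtain ⟨p, hp⟩ := hf; obtain ⟨q, hq⟩ := hg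
  exact ⟨p * q, fun n => by rw [eval_mul]; exact Nat.mul_le_mul (hp n) (hq n)⟩

/-- Post-composition with a polynomial. [folklore] -/
private theorem isPolyBounded_eval'' (r : Polynomial ℕ) {f : ℕ → ℕ} (hf : IsPolyBounded f) : IsPolyBounded fun n => r.eval (f n) := by
  obtain ⟨p, hp⟩ := hf
  exact ⟨r.comp p, fun n => by rw [eval_comp]; exact TM2Iter.eval_mono r (hp n)⟩

/-- `matBound n (m n) (q n)` is polynomially bounded. [folklore] -/
theorem isPolyBounded_matBound {q m : ℕ → ℕ} (hq : IsPolyBounded q) (hm : IsPolyBounded m) :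
    IsPolyBounded fun n => SIS.matBound n (m n) (q n) := by
  have hid : IsPolyBounded fun n => n := ⟨X, fun n => by simp⟩
  have hc : ∀ C : ℕ, IsPolyBounded fun _ => C := fun C => ⟨Polynomial.C C, fun n => by simp⟩
  have h2 : ∀ {f : ℕ → ℕ}, IsPolyBounded f → IsPolyBounded fun n => 2 * f n + 2 := fun hf =>
    isPolyBounded_add'' (isPolyBounded_mul'' (hc 2) hf) (hc 2)
  have hin : IsPolyBounded fun n => 2 * m n + 2 + m n * (2 * q n + 2) := isPolyBounded_add'' (h2 hm) (isPolyBounded_mul'' hm (h2 hq))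
  have hrow : IsPolyBounded fun n => 2 * (2 * m n + 2 + m n * (2 * q n + 2)) + 2 := h2 hin
  have hbody : IsPolyBounded fun n => 2 * n + 2 + n * (2 * (2 * m n + 2 + m n * (2 * q n + 2)) + 2) :=
    isPolyBounded_add'' (h2 hid) (isPolyBounded_mul'' hid hrow)
  have h := isPolyBounded_add'' (h2 hid) (isPolyBounded_add'' (h2 hm) (isPolyBounded_add'' (h2 hq) hbody))
  exact isPolyBounded_of_le'' h fun n => by simp only [SIS.matBound]; exact le_rfl

/-- A binary parameter that is polynomially bounded is computed in unary. [cite: AroraBarak2009, §1.3] -/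
theorem codeFP_unary_of_natParam {f : ℕ → ℕ} (hf : PolyTimeComputable unaryEncodeNat encodeNat f) (hb : IsPolyBounded f) :
    CodeFP unE unE f := by
  obtain ⟨p, hp⟩ := hb
  exact (unOfNatMin.comp ((MRLemma510.unPoly p).pair (CodeFP.codeFP_natParam hf))).congr fun n => min_eq_left (hp n)

/-- The floor of the rational parameter `a` is computed in unary (`⌊β⌋ = ⌊a⌋ = num/den`). [cite: AroraBarak2009, §1.3] -/
theorem codeFP_unary_floor {β : ℕ → ℝ} {a : ℕ → ℚ} (ha : ∀ n, β n = a n)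
    (hac : PolyTimeComputable unaryEncodeNat Literature.Algebra.EuclideanLattices.encodeRat a) (hb : IsPolyBoundedReal β) :
    CodeFP unE unE fun n => ⌊β n⌋₊ := by
  obtain ⟨p, hp⟩ := hb
  have hnd := CodeFP.codeFP_ratParam hac
  have hfl : CodeFP unE natE (fun n => ((a n).num / ((a n).den : ℤ)).toNat) :=
    (intToNat.comp (intEDiv.comp ((intOfSM.comp hnd.fst').pair (intOfNat.comp hnd.snd')))).congr fun _ => rfl
  have heq : ∀ n, ((a n).num / ((a n).den : ℤ)).toNat = ⌊β n⌋₊ := by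
    intro n
    rw [← Rat.floor_def', ← Int.floor_toNat, ha n, Rat.floor_cast]
  have hle : ∀ n, ⌊β n⌋₊ ≤ p.eval n := fun n => Nat.floor_le_of_le (hp n)
  exact ((unOfNatMin.comp ((MRLemma510.unPoly p).pair hfl)) :).congr fun n => by rw [heq n]; exact min_eq_left (hle n)

/-- The precision eventually stays below the dimension: `80 + size (p n) ≤ n` for large `n`. [folklore] -/
theorem eventually_precOf_le (p : Polynomial ℕ) : ∃ n₁ : ℕ, ∀ n, n₁ ≤ n → precOf p n ≤ n := by
  obtain ⟨d, hd⟩ := IsPolyBounded.eventually_le_pow (f := fun n => p.eval n) ⟨p, fun _ => le_rfl⟩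
  have h2 := eventually_mul_pow_le_two_pow d ((2 : ℝ) ^ 81)
  obtain ⟨n₁, hn₁⟩ := Filter.eventually_atTop.1 (hd.and h2)
  refine ⟨max n₁ 1, fun n hn => ?_⟩
  obtain ⟨hpn, h2n⟩ := hn₁ n ((le_max_left _ _).trans hn)
  have hn1 : 1 ≤ n := (le_max_right _ _).trans hn
  -- `2^81 n^d ≤ 2^n` forces `81 ≤ n` and `p n ≤ n^d ≤ 2^(n - 81)`
  have h81 : 81 ≤ n := by
    by_contra hlt
    have hnd : (1 : ℝ) ≤ (n : ℝ) ^ d := one_le_pow₀ (by exact_mod_cast hn1)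
    have : (2 : ℝ) ^ n < 2 ^ 81 := pow_lt_pow_right₀ (by norm_num) (by omega)
    nlinarith
  have hpow : ((p.eval n : ℕ) : ℝ) ≤ 2 ^ (n - 81) := by
    have h1 : ((p.eval n : ℕ) : ℝ) ≤ (n : ℝ) ^ d := by exact_mod_cast hpn
    have h3 : (2 : ℝ) ^ n = 2 ^ 81 * 2 ^ (n - 81) := by rw [← pow_add]; congr 1; omega
    rw [h3] at h2n
    have h4 : (n : ℝ) ^ d ≤ 2 ^ (n - 81) := le_of_mul_le_mul_left (by linarith) (by positivity : (0 : ℝ) < 2 ^ 81)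
    exact h1.trans h4
  have hlt : p.eval n < 2 ^ (n - 80) := by
    have h5 : (2 : ℝ) ^ (n - 81) < 2 ^ (n - 80) := pow_lt_pow_right₀ (by norm_num) (by omega)
    exact_mod_cast hpow.trans_lt h5
  have hsz : Nat.size (p.eval n) ≤ n - 80 := Nat.size_le.2 hlt
  unfold precOf; omega

/-- **`H59a`: the machine-level single attempt of MR07 Thm. 5.9** — for a PPT `SIS′` solver with advantage
`≥ 1/n^c` on `S` there are `g`, a PPT attempt `Att` with a polynomial coin budget, `G`, `e`, `n₀` such that
every well-formed promise instance of dimension `n ∈ S`, `n ≥ n₀`, is answered well with probability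
`≥ 1/n^e` for some guess `i < G(n)`. The hypothesis of
`MRThm59Shell.owfExist_of_gapSVP_worstCaseHard_of_incGDDAttempt`.
[cite: MicciancioRegev2007, Thm. 5.9 (statement p. 22, proof pp. 22–24)] -/
theorem H59a_holds : ∀ (q m : ℕ → ℕ) [∀ n, NeZero (q n)] (β : ℕ → ℝ),
      IsPolyBounded q → IsPolyBounded m → IsPolyBoundedReal β → IsPolyTimeParams q β m →
      (∀ n, 0 < β n) → MRModulusCondition q m β →
      ∀ B : RandAlg (List Bool) (List Bool), IsPPT B id → ∀ (c : ℕ) (S : Set ℕ),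
        (∀ n ∈ S, 1 / (n : ℝ) ^ c ≤ SIS.successProb' B n (m n) (q n) (β n)) →
        ∃ g : ℕ → ℝ, IsPolyBoundedReal g ∧ (∀ n, 0 ≤ g n) ∧
        ∃ Att : RandAlg (List Bool) (List Bool), IsPPT Att id ∧
          (∃ pA : Polynomial ℕ, ∀ k, Att.coinLen k = pA.eval k) ∧ ∃ G : Polynomial ℕ,
          ∃ (e n₀ : ℕ), ∀ J : IncGDDInst, J.WellFormed → J.n ∈ S → n₀ ≤ J.n → J.Promise (g J.n) →
            ∃ i < G.eval J.n, ∀ w : List Bool,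
              1 / (J.n : ℝ) ^ e ≤ Att.pr id (boolPair J.encode (boolPair (unE i) w)) J.goodAnswers := by
  intro q m _ β hq hm hβ hpar hβ0 hmod B hB c S hS
  -- the public parameters on unary codes
  obtain ⟨hqc, hmc, a, ha, hac⟩ := hpar
  have hqU : CodeFP unE unE q := codeFP_unary_of_natParam hqc hq
  have hmU : CodeFP unE unE m := codeFP_unary_of_natParam hmc hm
  have hβU : CodeFP unE unE (fun n => ⌊β n⌋₊) := codeFP_unary_floor ha hac hβ
  -- the solver's coin budget and the call's lengths
  obtain ⟨pB, hpB⟩ := hB.2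
  set R : ℕ → ℕ := fun n => pB.eval (SIS.matBound n (m n) (q n)) with hR
  set W : ℕ → ℕ := fun n => Nat.size (R n) with hW
  have hRle : ∀ n (A : Matrix (Fin n) (Fin (m n)) (ZMod (q n))), B.coinLen (SIS.encodeMatrix A).length ≤ R n := fun n A =>
    (hpB _).trans (TM2Iter.eval_mono pB (SIS.length_encodeMatrix_le A))
  have hK : ∀ n (A : Matrix (Fin n) (Fin (m n)) (ZMod (q n))) (E : Set (List Bool)),
      (2⁻¹ : ℝ) ^ W n * B.pr id (SIS.encodeMatrix A) E ≤ ((callLaw B (W n) (R n) (SIS.encodeMatrix A)).toOuterMeasure E).toReal :=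
    fun n A E => le_toReal_callLaw (hRle n A) ((hRle n A).trans_lt (Nat.lt_size_self _)) E
  have hWpoly : IsPolyBounded fun n => 2 ^ W n := by
    have hRp : IsPolyBounded R := isPolyBounded_eval'' pB (isPolyBounded_matBound hq hm)
    have hc2 : IsPolyBounded fun _ : ℕ => 2 := ⟨Polynomial.C 2, fun n => by simp⟩
    have hc1 : IsPolyBounded fun _ : ℕ => 1 := ⟨Polynomial.C 1, fun n => by simp⟩
    refine isPolyBounded_of_le'' (isPolyBounded_add'' (isPolyBounded_mul'' hc2 hRp) hc1) fun n => ?_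
    show 2 ^ Nat.size (R n) ≤ 2 * R n + 1
    rcases Nat.eq_zero_or_pos (R n) with h0 | hpos
    · rw [h0, Nat.size_zero]; norm_num
    · have hs : 0 < Nat.size (R n) := Nat.size_pos.2 hpos
      have h1 : 2 ^ (Nat.size (R n) - 1) ≤ R n := Nat.lt_size.1 (Nat.sub_lt hs Nat.one_pos)
      calc 2 ^ Nat.size (R n) = 2 * 2 ^ (Nat.size (R n) - 1) := by rw [← pow_succ']; congr 1; omega
        _ ≤ 2 * R n + 1 := by omega
  -- the samplers
  set D : Polynomial ℕ → IncGDDInst → ℤ → PMF ℤ := fun p J α => (PGParams.std (precOf p J.n) (bOf J (q J.n) α)).lawPMF with hD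
  have hDtv : ∀ p : Polynomial ℕ, ∃ n₁ : ℕ, ∀ J : IncGDDInst, J.WellFormed → n₁ ≤ J.n → ∀ α : ℤ, α ≠ 0 → 1 ≤ J.rn →
      (discreteGaussianInt ((NOf J α (N1Of J (q J.n) (⌊β J.n⌋₊ + 1)) : ℝ) * sOf J (q J.n) (⌊β J.n⌋₊ + 1) α) 0).tvDist (D p J α) ≤
        20 / (((p.eval J.n : ℕ) : ℝ) + 1) := by
    intro p
    obtain ⟨n₁, hn₁⟩ := eventually_precOf_le p
    refine ⟨n₁, fun J hJ hn α hα hrn => ?_⟩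
    have hq0 : 0 < q J.n := Nat.pos_of_ne_zero (NeZero.ne (q J.n))
    have hβup : 1 ≤ ⌊β J.n⌋₊ + 1 := by omega
    rw [NOf_mul_sOf hJ hq0 hβup hα, hD, PMF.tvDist_comm]
    have hprec : precOf p J.n ≤ J.n := hn₁ J.n hn
    have hm1 : 1 ≤ precOf p J.n := by unfold precOf; omega
    have hb : precOf p J.n + PGParams.rOf (precOf p J.n) + 1 ≤ bOf J (q J.n) α := by
      have h1 := le_bOf hJ hq0 hα hrn
      have h2 : PGParams.rOf (precOf p J.n) ≤ PGParams.rOf J.n := by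
        unfold PGParams.rOf; exact Nat.add_le_add_right (Nat.log_mono_right (by omega)) 1
      omega
    refine (PGParams.tvDist_lawPMF_std_discreteGaussianInt_le (precOf p J.n) (bOf J (q J.n) α) hm1 hb).trans ?_
    -- `20 · 2^{-prec} ≤ 20/(p n + 1)` since `2^{prec} = 2^{80} 2^{size (p n)} ≥ p n + 1`
    have hge : ((p.eval J.n : ℕ) : ℝ) + 1 ≤ (2 : ℝ) ^ precOf p J.n := by
      have h1 : p.eval J.n + 1 ≤ 2 ^ Nat.size (p.eval J.n) := Nat.lt_size_self _
      have h2 : 2 ^ Nat.size (p.eval J.n) ≤ 2 ^ precOf p J.n := Nat.pow_le_pow_right (by norm_num) (by unfold precOf; omega)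
      exact_mod_cast h1.trans h2
    rw [div_eq_mul_inv]
    exact mul_le_mul_of_nonneg_left ((inv_le_inv₀ (by positivity) (by positivity)).2 hge) (by norm_num)
  -- the machines, one per precision polynomial
  have hMach := fun p : Polynomial ℕ => exists_attMachine hqU hmU hβU p pB B hB
  choose Att hAttPPT hAttCoin hAttLaw using hMach
  -- the assembly
  obtain ⟨p, G, e, n₀, hmain⟩ := attempt_success_of_law q m β hm hβ hmod B c S hS W hWpoly
    (fun n A => callLaw B (W n) (R n) (SIS.encodeMatrix A)) hK D hDtv Att (fun p J hJ _ j₀ a' w => hAttLaw p J hJ j₀ a' w)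
  refine ⟨fun n => 3 * ((⌊β n⌋₊ + 1 : ℕ) : ℝ) * n, ?_, fun n => by positivity, Att p, hAttPPT p, hAttCoin p, G, e, n₀,
    fun J hJ hS' hn hprom => hmain J hJ hS' hn hprom⟩
  -- `g` is polynomially bounded
  obtain ⟨pβ, hpβ⟩ := hβ
  refine ⟨3 * (pβ + 1) * X, fun n => ?_⟩
  have h1 : ((⌊β n⌋₊ + 1 : ℕ) : ℝ) ≤ ((pβ.eval n + 1 : ℕ) : ℝ) := by
    exact_mod_cast Nat.add_le_add_right (Nat.floor_le_of_le (hpβ n)) 1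
  have h2 : (((3 * (pβ + 1) * X).eval n : ℕ) : ℝ) = 3 * ((pβ.eval n + 1 : ℕ) : ℝ) * n := by
    simp only [eval_mul, eval_add, eval_one, eval_X, eval_ofNat]; push_cast; ring
  rw [h2]
  have hn0 : (0 : ℝ) ≤ n := Nat.cast_nonneg n
  nlinarith

end Final

end MRThm59

end Literature.Algebra.EuclideanLattices

end
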